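import Summits.CriticalPhenomena.PercolationContinuityZ3.Theorems.PercNearOneGluingNoHeavyLowerTailMajorityGluingTypeTableFixedMIso
import Summits.CriticalPhenomena.PercolationContinuityZ3.Theorems.PercNearOneGluingNoHeavyLowerTailMajorityGluingTypeTableFixedMCellDefs
import HarnessLib

/-!
# The fixed-`M` programme in the kernel, template C: Σ₄-CELLS and the ISO₄ chord row (the bottom of the window)
(lane prim-rate, constants-miner 1, gen 29; KERNEL-WINDOW.md §0 (4)–(5), §4 (3); CONVEX-BOOTSTRAP.md §5 «cells in (A, Σ₄)»)

Support file for the closed crux `NoHeavyLowerTail` (stmt-CriticalPhenomena-4575), majority-gluing line; continuation of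
`…TypeTableFixedMIso` (template B: `BRow`, `checkFMB`, `FMLawB`, `fixedMB_sound`).  The cell-free fixed-`M` chain stalls near
`M ≈ 0.0063` (certified ratio `Ē/M → 0.99`), above THEOREM BOTTOM-3's take-over `0.0057`.  The lane's Python-certified window
(gen 25) used CELLS in `Σ₄ := Σ_z (S_z + T_z)`; inside a cell `4·t_lo ≤ Σ₄ ≤ 4·t_hi` the ISO₄ row of `{1,2,3,4}`,
`U₄^{c₄} ≤ M^{4−c₄}·Π_z (S_z+T_z)`, gives by AM–GM `U₄ ≤ M^{κ₀}·(Σ₄/4)^{4/c₄}` (`κ₀ = 4/c₄ − 1`), and since `4/c₄ = 1.6277… ≥ 1`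
the map `t ↦ t^{4/c₄}` is CONVEX, so on the cell it lies below its chord: with certified rational bounds `G_lo ≥ t_lo^{4/c₄}`,
`G_hi ≥ t_hi^{4/c₄}` and the grid bound `M^{κ₀} ≤ Cu4 k` (`…TypeTableFixedMGrid.scaled_const_le`), every row
`N·U₄ − B·Σ₄ ≤ A` with `N·Cu4 k·G_lo − 4B·t_lo ≤ A` and `N·Cu4 k·G_hi − 4B·t_hi ≤ A` is VALID on the cell — a pure-`ℚ` check.

* data side in `…TypeTableFixedMCellDefs` (`sig4φ`, `Cell`, `CELLS`, `Cu4`, `CRow`, `CRow.ok`, `checkFMC`); here `Cell.Valid`, `FMLawC`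
  (= `FMLawB` + the cell), `amgm4`, `chord_rpow`, `u4_chord` (the analytic facts), **`fixedMC_sound`** (`checkFMC = true` ⟹ `E ≤ V`
  on the cell), `cell1_valid … cell4_valid` (the constants of `CELLS` certified by `RpowCert.rpow_le_cert`), **`cell_cover4`** (the four
  cells exhaust `Σ₄ ∈ [0, 8]`, so per-cell certificates give `E ≤ V` for every law of the case).

Measured (kit j245952, gen 29): with these rows the certified ratio at `M = 2^{-230/32} … 2^{-240/32}` drops from `0.975 … 1.004`
to `0.78 … 0.83`, so two or three cell points close the kernel window down to BOTTOM-3.  No sorries.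
[cite: VandenbergHaggstromKahn2005, Thm. 1.3 (p. 6)]
-/

namespace Summit.CriticalPhenomena.PercolationContinuityZ3.Theorems

namespace HubOnly
namespace TypeTable

open DType

/-- The cell constants are valid: `0 ≤ t_lo < t_hi`, `t_lo^{4/c₄} ≤ G_lo`, `t_hi^{4/c₄} ≤ G_hi`. -/
def Cell.Valid (c : Cell) : Prop :=
  0 ≤ c.tlo ∧ c.tlo < c.thi ∧ ((c.tlo : ℚ) : ℝ) ^ (4 * ((3 + Real.sqrt (11 / 3)) / 2)⁻¹) ≤ ((c.Glo : ℚ) : ℝ) ∧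
    ((c.thi : ℚ) : ℝ) ^ (4 * ((3 + Real.sqrt (11 / 3)) / 2)⁻¹) ≤ ((c.Ghi : ℚ) : ℝ)

noncomputable section

variable {cs : FMCase} {k : ℕ} {M : ℝ} {x : DType → ℝ}

/-- The hypotheses of template C: template B and the cell. -/
structure FMLawC (cs : FMCase) (c : Cell) (k : ℕ) (M : ℝ) (x : DType → ℝ) : Prop extends FMLawB cs k M x where
  /-- the cell's lower end -/
  cellLo : 4 * ((c.tlo : ℚ) : ℝ) ≤ lin sig4φ x
  /-- the cell's upper end -/
  cellHi : lin sig4φ x ≤ 4 * ((c.thi : ℚ) : ℝ)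

/-! ### Analytic facts -/

/-- `4/c₄ ≥ 1` and the exponent facts of `c₄`. -/
theorem four_c4_facts : 0 < (3 + Real.sqrt (11 / 3)) / 2 ∧ 1 ≤ 4 * ((3 + Real.sqrt (11 / 3)) / 2)⁻¹ ∧
    ((599 : ℤ) : ℝ) / ((368 : ℕ) : ℝ) ≤ 4 * ((3 + Real.sqrt (11 / 3)) / 2)⁻¹ ∧
    4 * ((3 + Real.sqrt (11 / 3)) / 2)⁻¹ ≤ ((3218 : ℤ) : ℝ) / ((1977 : ℕ) : ℝ) := by
  obtain ⟨h1, h2⟩ := RpowCert.inv_c4_bounds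
  refine ⟨by positivity, by linarith, by push_cast; linarith, by push_cast; linarith⟩

/-- AM–GM for four nonnegative reals: `abcd ≤ ((a+b+c+d)/4)^4`. -/
theorem amgm4 {a b c d : ℝ} (ha : 0 ≤ a) (hb : 0 ≤ b) (hc : 0 ≤ c) (hd : 0 ≤ d) :
    a * b * c * d ≤ ((a + b + c + d) / 4) ^ 4 := by
  have h1 : a * b ≤ ((a + b) / 2) ^ 2 := by nlinarith [sq_nonneg (a - b)]
  have h2 : c * d ≤ ((c + d) / 2) ^ 2 := by nlinarith [sq_nonneg (c - d)]
  have h3 : ((a + b) / 2) ^ 2 * ((c + d) / 2) ^ 2 ≤ ((a + b + c + d) / 4) ^ 4 := by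
    have h4 : ((a + b) / 2) * ((c + d) / 2) ≤ ((a + b + c + d) / 4) ^ 2 := by nlinarith [sq_nonneg ((a + b) / 2 - (c + d) / 2)]
    have h5 : 0 ≤ ((a + b) / 2) * ((c + d) / 2) := by positivity
    nlinarith
  calc a * b * c * d = (a * b) * (c * d) := by ring
    _ ≤ ((a + b) / 2) ^ 2 * ((c + d) / 2) ^ 2 := mul_le_mul h1 h2 (by positivity) (by positivity)
    _ ≤ _ := h3

/-- The chord of a convex power: `1 ≤ q`, `0 ≤ a < b`, `t ∈ [a, b]` ⟹ `t^q ≤ ((b − t)·a^q + (t − a)·b^q)/(b − a)`. -/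
theorem chord_rpow {q a b t : ℝ} (hq : 1 ≤ q) (ha : 0 ≤ a) (hab : a < b) (hat : a ≤ t) (htb : t ≤ b) :
    t ^ q ≤ ((b - t) * a ^ q + (t - a) * b ^ q) / (b - a) := by
  have hconv := convexOn_rpow hq
  have hba : 0 < b - a := by linarith
  set θ := (b - t) / (b - a) with hθ
  have hθ0 : 0 ≤ θ := div_nonneg (by linarith) hba.le
  have hθ1 : θ ≤ 1 := by rw [hθ, div_le_one hba]; linarith
  have h := hconv.2 (Set.mem_Ici.mpr ha) (Set.mem_Ici.mpr (ha.trans hab.le)) hθ0 (by linarith : 0 ≤ 1 - θ) (by ring)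
  have et : θ • a + (1 - θ) • b = t := by
    simp only [smul_eq_mul]; rw [hθ]; field_simp; ring
  rw [et] at h
  simp only [smul_eq_mul] at h
  have e2 : θ * a ^ q + (1 - θ) * b ^ q = ((b - t) * a ^ q + (t - a) * b ^ q) / (b - a) := by
    rw [hθ]; field_simp; ring
  linarith [e2]

/-- `lin sig4φ = Σ_z (S_z + T_z)`. -/
theorem lin_sig4 (x : DType → ℝ) :
    lin sig4φ x = (Sm 1 x + Tm 1 x) + (Sm 2 x + Tm 2 x) + (Sm 3 x + Tm 3 x) + (Sm 4 x + Tm 4 x) := by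
  simp only [sig4φ, lin_combo, List.map_cons, List.map_nil, List.sum_cons, List.sum_nil, Sm, Tm]
  push_cast
  ring

/-- **The ISO₄ chord bound.**  In a valid cell, `U₄ ≤ Cu4 k · ((t_hi − t)·G_lo + (t − t_lo)·G_hi)/(t_hi − t_lo)`, `t = Σ₄/4`. -/
theorem u4_chord {c : Cell} (hc : c.Valid) (L : FMLawC cs c k M x) :
    uS [1, 2, 3, 4] x ≤ ((Cu4 k : ℚ) : ℝ) *
      (((c.thi : ℝ) - lin sig4φ x / 4) * c.Glo + (lin sig4φ x / 4 - c.tlo) * c.Ghi) / ((c.thi : ℝ) - c.tlo) := by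
  obtain ⟨htlo, hlt, hGlo, hGhi⟩ := hc
  obtain ⟨hcpos, hq1, -, -⟩ := four_c4_facts
  have hx := L.nonneg
  set cc := (3 + Real.sqrt (11 / 3)) / 2 with hcc
  set t := lin sig4φ x / 4 with ht
  have st0 : ∀ z ∈ [1, 2, 3, 4], 0 ≤ Sm z x + Tm z x := fun z _ => add_nonneg (lin_ind_nonneg _ hx) (lin_ind_nonneg _ hx)
  have hK : 0 ≤ M ^ (4 - cc) := Real.rpow_nonneg L.Mpos.le _
  -- AM–GM on the ISO₄ row
  have hprod : (Sm 1 x + Tm 1 x) * (Sm 2 x + Tm 2 x) * (Sm 3 x + Tm 3 x) * (Sm 4 x + Tm 4 x) ≤ t ^ (4 : ℕ) := by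
    have h := amgm4 (st0 1 (by simp)) (st0 2 (by simp)) (st0 3 (by simp)) (st0 4 (by simp))
    have e : ((Sm 1 x + Tm 1 x) + (Sm 2 x + Tm 2 x) + (Sm 3 x + Tm 3 x) + (Sm 4 x + Tm 4 x)) / 4 = t := by
      rw [ht, lin_sig4]
    rw [e] at h; exact h
  have ht0 : 0 ≤ t := by
    rw [ht, lin_sig4]; linarith [st0 1 (by simp), st0 2 (by simp), st0 3 (by simp), st0 4 (by simp)]
  have row : uS [1, 2, 3, 4] x ^ cc ≤ M ^ (4 - cc) * t ^ (4 : ℕ) := by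
    have h := L.iso4
    calc _ ≤ M ^ (4 - cc) * ((Sm 1 x + Tm 1 x) * (Sm 2 x + Tm 2 x) * (Sm 3 x + Tm 3 x) * (Sm 4 x + Tm 4 x)) := by
          rw [hcc]; linarith [h]
      _ ≤ _ := mul_le_mul_of_nonneg_left hprod hK
  -- root form: U₄ ≤ (M^{4−c})^{1/c} · t^{4/c}
  have hu0 : 0 ≤ uS [1, 2, 3, 4] x := lin_ind_nonneg _ hx
  have h1 := RpowCert.le_rpow_inv hu0 hcpos row
  have e1 : (M ^ (4 - cc) * t ^ (4 : ℕ)) ^ cc⁻¹ = (M ^ (4 - cc)) ^ cc⁻¹ * t ^ (4 * cc⁻¹) := by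
    rw [Real.mul_rpow hK (by positivity), ← Real.rpow_natCast t 4, ← Real.rpow_mul ht0]; norm_num
  rw [e1] at h1
  -- the constant on the grid
  have hC : (M ^ (4 - cc)) ^ cc⁻¹ ≤ ((Cu4 k : ℚ) : ℝ) := by
    have h := scaled_const_le (n := 4) L.Mpos L.Mle hcpos (by rw [hcc]; linarith) (by decide +kernel)
      theta4_bounds.1 theta4_bounds.2 (k := k)
    simp only [Cu4]; push_cast at h ⊢
    exact h
  -- the chord
  have htlo' : ((c.tlo : ℚ) : ℝ) ≤ t := by have := L.cellLo; rw [ht]; linarith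
  have hthi' : t ≤ ((c.thi : ℚ) : ℝ) := by have := L.cellHi; rw [ht]; linarith
  have hlt' : ((c.tlo : ℚ) : ℝ) < ((c.thi : ℚ) : ℝ) := by exact_mod_cast hlt
  have htlo0 : (0 : ℝ) ≤ ((c.tlo : ℚ) : ℝ) := by exact_mod_cast htlo
  have h2 := chord_rpow hq1 htlo0 hlt' htlo' hthi'
  have hden : 0 < ((c.thi : ℚ) : ℝ) - c.tlo := by linarith
  have h3 : t ^ (4 * cc⁻¹) ≤ ((c.thi - t) * c.Glo + (t - c.tlo) * c.Ghi) / ((c.thi : ℝ) - c.tlo) := by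
    refine h2.trans (div_le_div_of_nonneg_right ?_ hden.le)
    have a1 : (c.thi - t) * ((c.tlo : ℚ) : ℝ) ^ (4 * cc⁻¹) ≤ (c.thi - t) * c.Glo :=
      mul_le_mul_of_nonneg_left hGlo (by linarith)
    have a2 : (t - c.tlo) * ((c.thi : ℚ) : ℝ) ^ (4 * cc⁻¹) ≤ (t - c.tlo) * c.Ghi :=
      mul_le_mul_of_nonneg_left hGhi (by linarith)
    linarith
  have hC0 : 0 ≤ ((Cu4 k : ℚ) : ℝ) := (Real.rpow_nonneg hK _).trans hC
  calc uS [1, 2, 3, 4] x ≤ (M ^ (4 - cc)) ^ cc⁻¹ * t ^ (4 * cc⁻¹) := h1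
    _ ≤ ((Cu4 k : ℚ) : ℝ) * t ^ (4 * cc⁻¹) := mul_le_mul_of_nonneg_right hC (Real.rpow_nonneg ht0 _)
    _ ≤ _ := by rw [mul_div_assoc]; exact mul_le_mul_of_nonneg_left h3 hC0

/-- **Chord-row validity**: the two endpoint checks make `N·U₄ − B·Σ₄ ≤ A` valid on the whole cell. -/
theorem u4chord_valid {c : Cell} (hc : c.Valid) (L : FMLawC cs c k M x) {N B : ℕ} {A : ℚ}
    (c1 : (N : ℚ) * Cu4 k * c.Glo - 4 * B * c.tlo ≤ A) (c2 : (N : ℚ) * Cu4 k * c.Ghi - 4 * B * c.thi ≤ A) :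
    (N : ℝ) * uS [1, 2, 3, 4] x + -(B : ℝ) * lin sig4φ x ≤ A := by
  have hU := u4_chord hc L
  obtain ⟨htlo, hlt, -, -⟩ := hc
  have hlt' : ((c.tlo : ℚ) : ℝ) < ((c.thi : ℚ) : ℝ) := by exact_mod_cast hlt
  set t := lin sig4φ x / 4 with ht
  have esig : lin sig4φ x = 4 * t := by rw [ht]; ring
  have htlo' : ((c.tlo : ℚ) : ℝ) ≤ t := by have := L.cellLo; rw [ht]; linarith
  have hthi' : t ≤ ((c.thi : ℚ) : ℝ) := by have := L.cellHi; rw [ht]; linarith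
  have c1' : (N : ℝ) * ((Cu4 k : ℚ) : ℝ) * c.Glo - 4 * B * c.tlo ≤ A := by
    have h := (Rat.cast_le (K := ℝ)).mpr c1; push_cast at h; exact h
  have c2' : (N : ℝ) * ((Cu4 k : ℚ) : ℝ) * c.Ghi - 4 * B * c.thi ≤ A := by
    have h := (Rat.cast_le (K := ℝ)).mpr c2; push_cast at h; exact h
  -- θ-combination of the two endpoint inequalities
  set θ := (((c.thi : ℚ) : ℝ) - t) / (((c.thi : ℚ) : ℝ) - c.tlo) with hθ
  have hden : 0 < ((c.thi : ℚ) : ℝ) - c.tlo := by linarith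
  have hθ0 : 0 ≤ θ := div_nonneg (by linarith) hden.le
  have hθ1 : θ ≤ 1 := by rw [hθ, div_le_one hden]; linarith
  have eU : ((Cu4 k : ℚ) : ℝ) * ((((c.thi : ℚ) : ℝ) - t) * c.Glo + (t - c.tlo) * c.Ghi) / (((c.thi : ℚ) : ℝ) - c.tlo) =
      ((Cu4 k : ℚ) : ℝ) * (θ * c.Glo + (1 - θ) * c.Ghi) := by
    rw [hθ]; field_simp; ring
  have et : 4 * t = θ * (4 * c.tlo) + (1 - θ) * (4 * ((c.thi : ℚ) : ℝ)) := by
    rw [hθ]; field_simp; ring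
  have hN0 : (0 : ℝ) ≤ N := Nat.cast_nonneg N
  have hUN : (N : ℝ) * uS [1, 2, 3, 4] x ≤ N * (((Cu4 k : ℚ) : ℝ) * (θ * c.Glo + (1 - θ) * c.Ghi)) := by
    rw [← eU]; exact mul_le_mul_of_nonneg_left hU hN0
  have k1 := mul_le_mul_of_nonneg_left c1' hθ0
  have k2 := mul_le_mul_of_nonneg_left c2' (by linarith : (0 : ℝ) ≤ 1 - θ)
  rw [esig, et]
  nlinarith

/-- **Row validity (template C).** -/
theorem crow_valid {c : Cell} (hc : c.Valid) (L : FMLawC cs c k M x) (hpos : ∀ z ∈ [1, 2, 3, 4], 0 < Tm z x)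
    (r : CRow) (hr : r.ok cs c k = true) : lin (r.toRow c).φ x ≤ ((r.toRow c).b : ℝ) := by
  cases r with
  | b br =>
    obtain ⟨hB2, hB3, hB4⟩ := L.budgets
    cases br with
    | base f => exact row_valid L.toFMLaw hpos f hr
    | junk z =>
      simp only [CRow.ok, BRow.ok, decide_eq_true_eq] at hr
      simpa [CRow.toRow, BRow.toRow] using junk_row_valid x L.nonneg hB2 hB3 hB4 hr
    | tan tr => exact trow_valid L.toFMLawB tr hr
  | sigLo =>
    have h := L.cellLo
    simp only [CRow.toRow, lin_combo, List.map_cons, List.map_nil, List.sum_cons, List.sum_nil]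
    push_cast; linarith
  | sigHi =>
    have h := L.cellHi
    simp only [CRow.toRow]; push_cast; linarith
  | u4chord N B A =>
    simp only [CRow.ok, Bool.and_eq_true, decide_eq_true_eq] at hr
    obtain ⟨⟨hN, c1⟩, c2⟩ := hr
    have h := u4chord_valid hc L c1 c2
    simp only [CRow.toRow, lin_combo, List.map_cons, List.map_nil, List.sum_cons, List.sum_nil, uS] at h ⊢
    push_cast at h ⊢
    linarith

/-- **THE FAMILY THEOREM (template C).**  If `checkFMC cs c k rows y V = true` for a valid cell `c` then `E(x) ≤ V` for
every law of the programme in case `cs` and cell `c` at hub weights `0 < M ≤ 2^{−k/32}`. -/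
theorem fixedMC_sound {c : Cell} (hc : c.Valid) {ks : List CRow} {y : List ℚ} {V : ℚ}
    (hchk : checkFMC cs c k ks y V = true) (L : FMLawC cs c k M x) : E x ≤ (V : ℝ) := by
  simp only [checkFMC, Bool.and_eq_true, List.all_eq_true, decide_eq_true_eq] at hchk
  obtain ⟨⟨hks, hV⟩, hcert⟩ := hchk
  by_cases hpos : ∀ z ∈ [1, 2, 3, 4], 0 < Tm z x
  · have hrows : ∀ r ∈ ks.map (CRow.toRow c), lin r.φ x ≤ (r.b : ℝ) := by
      intro r hr
      obtain ⟨cr, hcr, rfl⟩ := List.mem_map.mp hr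
      exact crow_valid hc L hpos cr (hks _ hcr)
    obtain ⟨hB2, hB3, hB4⟩ := L.budgets
    exact lpCert_sound hcert x L.nonneg (nonInert_le_one x L.nonneg L.norm hB2 hB3 hB4) hrows
  · push Not at hpos
    obtain ⟨z, hz, hTz⟩ := hpos
    have hE := L.E_le_Tm z hz
    have hV' : (0 : ℝ) ≤ (V : ℝ) := by exact_mod_cast hV
    linarith

/-! ### The four cells: certified constants and the cover -/

/-- `4/c₄` brackets for the certificates: `599/368 ≤ 4/c₄ ≤ 3218/1977` (continued-fraction convergents). -/
theorem four_c4_brackets : ((599 : ℤ) : ℝ) / ((368 : ℕ) : ℝ) ≤ 4 * ((3 + Real.sqrt (11 / 3)) / 2)⁻¹ ∧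
    4 * ((3 + Real.sqrt (11 / 3)) / 2)⁻¹ ≤ ((3218 : ℤ) : ℝ) / ((1977 : ℕ) : ℝ) := ⟨four_c4_facts.2.2.1, four_c4_facts.2.2.2⟩

/-- Cell 1 `[0, 1/10]`: `0^{4/c₄} = 0`, `(1/10)^{4/c₄} ≤ 0.0235659`. -/
theorem cell1_valid : Cell.Valid ⟨0, 1 / 10, 0, 235659 / 10 ^ 7⟩ := by
  obtain ⟨hql, hqu⟩ := four_c4_brackets
  have hq0 : (4 * ((3 + Real.sqrt (11 / 3)) / 2)⁻¹) ≠ 0 := by linarith [four_c4_facts.2.1]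
  refine ⟨le_rfl, by norm_num, by push_cast; rw [Real.zero_rpow hq0], ?_⟩
  exact RpowCert.rpow_le_cert (a := 599) (b := 368) (by norm_num) (by norm_num) (by norm_num) (Or.inl ⟨by norm_num, hql⟩)
    (by decide +kernel)

/-- Cell 2 `[1/10, 1/5]`: `(1/5)^{4/c₄} ≤ 0.072824`. -/
theorem cell2_valid : Cell.Valid ⟨1 / 10, 1 / 5, 235659 / 10 ^ 7, 72824 / 10 ^ 6⟩ := by
  obtain ⟨hql, hqu⟩ := four_c4_brackets
  refine ⟨by norm_num, by norm_num, cell1_valid.2.2.2, ?_⟩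
  exact RpowCert.rpow_le_cert (a := 599) (b := 368) (by norm_num) (by norm_num) (by norm_num) (Or.inl ⟨by norm_num, hql⟩)
    (by decide +kernel)

/-- Cell 3 `[1/5, 2/5]`: `(2/5)^{4/c₄} ≤ 0.225044`. -/
theorem cell3_valid : Cell.Valid ⟨1 / 5, 2 / 5, 72824 / 10 ^ 6, 225044 / 10 ^ 6⟩ := by
  obtain ⟨hql, hqu⟩ := four_c4_brackets
  refine ⟨by norm_num, by norm_num, cell2_valid.2.2.2, ?_⟩
  exact RpowCert.rpow_le_cert (a := 599) (b := 368) (by norm_num) (by norm_num) (by norm_num) (Or.inl ⟨by norm_num, hql⟩)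
    (by decide +kernel)

/-- Cell 4 `[2/5, 2]`: `2^{4/c₄} ≤ 3.09024`. -/
theorem cell4_valid : Cell.Valid ⟨2 / 5, 2, 225044 / 10 ^ 6, 309024 / 10 ^ 5⟩ := by
  obtain ⟨hql, hqu⟩ := four_c4_brackets
  refine ⟨by norm_num, by norm_num, cell3_valid.2.2.2, ?_⟩
  exact RpowCert.rpow_le_cert (a := 3218) (b := 1977) (by norm_num) (by norm_num) (by norm_num) (Or.inr ⟨by norm_num, hqu⟩)
    (by decide +kernel)

/-- **THE CELL COVER.**  `Σ₄ ∈ [0, 8]` for every law of the programme (`S_z + T_z ≤ 2`), so bounds `E ≤ V` on the four cells of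
`CELLS` give `E ≤ V` for every law of the case. -/
theorem cell_cover4 {V : ℝ}
    (h1 : ∀ (M : ℝ) (x : DType → ℝ), FMLawC cs ⟨0, 1 / 10, 0, 235659 / 10 ^ 7⟩ k M x → E x ≤ V)
    (h2 : ∀ (M : ℝ) (x : DType → ℝ), FMLawC cs ⟨1 / 10, 1 / 5, 235659 / 10 ^ 7, 72824 / 10 ^ 6⟩ k M x → E x ≤ V)
    (h3 : ∀ (M : ℝ) (x : DType → ℝ), FMLawC cs ⟨1 / 5, 2 / 5, 72824 / 10 ^ 6, 225044 / 10 ^ 6⟩ k M x → E x ≤ V)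
    (h4 : ∀ (M : ℝ) (x : DType → ℝ), FMLawC cs ⟨2 / 5, 2, 225044 / 10 ^ 6, 309024 / 10 ^ 5⟩ k M x → E x ≤ V)
    (L : FMLawB cs k M x) : E x ≤ V := by
  have hx := L.nonneg
  obtain ⟨hB2, hB3, hB4⟩ := L.budgets
  have st0 : ∀ z ∈ [1, 2, 3, 4], 0 ≤ Sm z x + Tm z x := fun z _ => add_nonneg (lin_ind_nonneg _ hx) (lin_ind_nonneg _ hx)
  have st2 := st_le_two x hx L.norm hB2 hB3 hB4
  have hsig := lin_sig4 x
  have lo : 0 ≤ lin sig4φ x := by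
    rw [hsig]; linarith [st0 1 (by simp), st0 2 (by simp), st0 3 (by simp), st0 4 (by simp)]
  have hi : lin sig4φ x ≤ 8 := by
    rw [hsig]; linarith [st2 1 (by simp), st2 2 (by simp), st2 3 (by simp), st2 4 (by simp)]
  by_cases c1 : lin sig4φ x ≤ 4 * (1 / 10)
  · exact h1 M x ⟨L, by push_cast; linarith, by push_cast; linarith⟩
  by_cases c2 : lin sig4φ x ≤ 4 * (1 / 5)
  · exact h2 M x ⟨L, by push_cast; linarith, by push_cast; linarith⟩
  by_cases c3 : lin sig4φ x ≤ 4 * (2 / 5)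
  · exact h3 M x ⟨L, by push_cast; linarith, by push_cast; linarith⟩
  · exact h4 M x ⟨L, by push_cast; linarith, by push_cast; linarith⟩

end

end TypeTable
end HubOnly

end Summit.CriticalPhenomena.PercolationContinuityZ3.Theorems
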